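import Literature.AlgebraicGeometry.AbelianSchemes.PDivisibleGroupBlockDocking        -- ★ (O-DOCK) B-p17: `RingAction.exists_blockDocking`
import Literature.AlgebraicGeometry.AbelianSchemes.PDivisibleGroupBlockCotangentRank  -- ★ DEAL 6 B-p12: `htan_hdim_block_of_lieSignature`
import Literature.AlgebraicGeometry.GroupSchemes.UnitComponentOfFiniteGroupScheme      -- ★ (b1a): `exists_unitComponent`
import Literature.AlgebraicGeometry.GroupSchemes.CartierDualDoubleAnnihilator          -- ★ `isCommMonObj_ker` (ED. 7: P6a v0.5b field `comm₀`)
import Literature.RingTheory.DedekindDomain.BlockIdempotentFamily                      -- ★ (O-CRT) p846342 §4: 𝒪-numerics of `Localization.AtPrime w`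
import Literature.AlgebraicGeometry.GroupSchemes.BTGroupOneDimBlockNumerics              -- ★ p850272 (re-homed P6b kit): `blockNumerics_of_line`
import Mathlib.RingTheory.DedekindDomain.Dvr
import HarnessLib

/-!
# F0 · P6d line ED. 7 — `F0_P6d_BlockDocking`: the `w`-block numerics of `A[p^∞]` AT A SPECIAL POINT, in `A`-currency

ED. 7 (2026-09-01, over ED. 6 f02d058cbdf4): ONE added existential component `(_ : IsCommMonObj G)` — the supplier of the P6a Defs v0.5b
field `comm₀` (★ `BTGroup.comm` + ★ `isCommMonObj_ker`); every other token of the head is ED. 6 verbatim.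

Cell `hodgecm-mathlib`, FLOOR 0, P6 «MOD programme», sub-desk F0P6d (K∕BT dealing desk, LEAD HANDOFF v5); crux hLiu418 =
`stmt-HodgeConjecture-24832` on `route-HodgeConjecture-HCCMUnconditional`.  HC_CM is proved only modulo the printed citations until
rung 0 closes; this line is count-neutral glue.  SORRY-FREE: no stubs — the two GEN inputs are BINDERS (sockets), everything else is ★ by name.

WHAT IT DOES (P6a Defs v0.5 (R-1), bus 2026-09-01T19:09:45Z: «(O-J)∕(O-LOC) become GEN՚s rows; P6b `blockNumerics_of_line` becomes GEN՚s
discharger»).  For an abelian variety `A` over an algebraically closed field `k` of characteristic `p` with a ring action `act` of a Dedekind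
domain `O`, a maximal ideal `w ∋ p` of `O` with `#(O ⧸ w) = p^f` and `(p) = w^e · 𝔟`, `w + 𝔟 = O`, and a block family `a` (★ (O-CRT)
`exists_blockIdempotentFamily`: `a n ≡ 1 mod w^{en}`, `a n ∈ 𝔟^n`), GIVEN the two GEN sockets at the point —
(S-H) `hrank`: the `w`-block `Fix ε_w ⊂ A[p^∞]` has height `2ef`;  (S-T) `hsig`: the Lie signature of `e_w = act (a n)` on `cot A` is `1` —
it DELIVERS the Defs v0.5 field block for `A`: a finite affine subgroup scheme `ιA : G ↪ A` representing the `w`-torsion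
(`hkerA : (∀ r ∈ w, t ≫ act.i r = 1) ↔ t factors through ιA`), the induced `O`-action `βG` on `G` (`βG c ≫ ιA = ιA ≫ act.i c`), a unit
component `jU : U ↪ G` with `Γ(U) ≃ k[X]∕(X^{p^{NU}})`, `NU ∈ {f, 2f}`, `F²` kills `U`, `rk G = q²`, `rk (G ∕ Ker F) = q`, `#G(k) ∈ {1, q}`, and
simplicity of `G(k)` under `O` — i.e. `G₀ grp₀ comm₀ aff₀ fin₀ ι₀G hι₀G hkerG₀ β₀ hβ₀ hβ₀G U₀ grpU₀ affU₀ jU₀ hU₀ NU₀ θU₀ hFFU₀ hrkG₀ hrkF₀ hpts₀ hsimple₀`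
at the point (`hrkF₀`՚s `kerFI p f G` is by definition the `RingHom.ker` written out below — P6c DICT `kerFI` is a `def` with exactly this body).

COMPOSITION (all ★): 𝒪-numerics of `𝒪 := Localization.AtPrime w` (Mathlib DVR instance; ★ (O-CRT) §4 `finite_residueField_localizationAtPrime`,
`natCard_residueField_localizationAtPrime_eq_pow`, `associated_pow_natCast`, `residue_algebraMap_localizationAtPrime_surjective`) → ★ (O-DOCK)
`RingAction.exists_blockDocking` (itself: ★ DEAL 3 `isRingActionBT_pDivisibleGroupMap` → ★ `homOfCompatibleFamily` → ★ (O-LOC)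
`exists_isRingActionBT_localization` → ★ (O-J) `forall_mem_comp_app_eq_one_iff_exists`) → ★ `exists_unitComponent` → ★-boxed kit
`Literature.AlgebraicGeometry.GroupSchemes.BTGroupOneDimBlockNumerics.blockNumerics_of_line` (★ p850272).

SOCKETS HANDED TO GEN (A-lane): (S-H) via ★ `BTGroup.Hom.hrank_of_baseChange_point` + the char-0 count (DEAL 5 (S-H-BT) packages the BT half);
(S-T) via ★ DEAL 1 `finrank_cotangent_fixLayer_eq` + ★ DEAL 2 `finrank_range_mapCotangent_torsionMap_eq` + the Kottwitz signature (DEAL 6 (S-T-tr)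
packages the translation `hsig → htan∕hdim`).

## References
* [Tate1967] J. T. Tate, *p-divisible groups*, Proc. Conf. Local Fields (Driebergen, 1966), Springer (1967), §2 (2.1)–(2.4).
* [HarrisTaylorAMS2001] M. Harris, R. Taylor, *The geometry and cohomology of some simple Shimura varieties*, Ann. of Math. Stud. 151 (2001), §II.1–II.2.
* [RapoportSmithlingZhang2020Diagonal] M. Rapoport, B. Smithling, W. Zhang, *Arithmetic diagonal cycles on unitary Shimura varieties*, Compos. Math. 156 (2020), §4.1.
* [Liu2021] Y. Liu, *Fourier–Jacobi cycles and arithmetic relative trace formula*, Camb. J. Math. 9 (2021), p. 136.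
-/

set_option autoImplicit false

noncomputable section


open CategoryTheory CategoryTheory.Limits AlgebraicGeometry MonoidalCategory CartesianMonoidalCategory
open Polynomial
open scoped MonObj Obj
open Literature.AlgebraicGeometry.Motives (SchemeOver relFrobeniusOver frobeniusTwistOver)
open Literature.AlgebraicGeometry.Motives.AbelianVariety (cotangentMap)
open Literature.AlgebraicGeometry.GroupSchemes
open Literature.AlgebraicGeometry.GroupSchemes.AffineGroupScheme (Alg)
open Literature.AlgebraicGeometry.GroupSchemes.GroupSchemeKernel (ker kerι)
open Literature.AlgebraicGeometry.GroupSchemes.BTGroup Literature.AlgebraicGeometry.GroupSchemes.BTGroup.Hom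
open Literature.AlgebraicGeometry.GroupSchemes.IsRingActionBT
open Literature.AlgebraicGeometry.AbelianSchemes Literature.AlgebraicGeometry.AbelianSchemes.AbelianSchemeOver
open Literature.AlgebraicGeometry.AbelianSchemes.AbelianSchemeOver.RingAction
open Literature.RingTheory.DedekindDomain
open Literature.AlgebraicGeometry.GroupSchemes.BTGroupOneDimBlockNumerics

namespace Literature.AlgebraicGeometry.AbelianSchemes.PDivisibleGroupBlockDockingOfLine

universe u v

section Head

variable {k : Type u} [Field k] [IsAlgClosed k] (p f : ℕ) [hpr : Fact p.Prime] [CharP k p] [ExpChar k p]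
  {A : AbelianSchemeOver (Spec (.of k))} [IsCommMonObj A.X] {g : ℕ} (hg : A.IsOfRelDim g)
  {O : Type v} [CommRing O] [IsDedekindDomain O] (act : RingAction O A)
  (w : Ideal O) [w.IsMaximal] (hw0 : w ≠ ⊥) (hpw : (p : O) ∈ w) (hf : Nat.card (O ⧸ w) = p ^ f)
  {e : ℕ} {𝔟 : Ideal O} (he : 0 < e) (hx : Ideal.span {(p : O)} = w ^ e * 𝔟) (hcop : w ⊔ 𝔟 = ⊤)
  (a : ℕ → O) (ha1 : ∀ n, a n - 1 ∈ w ^ (e * n)) (ha2 : ∀ n, a n ∈ 𝔟 ^ n)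
  -- SOCKET (S-H): the `w`-block has height `2ef`
  (hrank : ∀ n (s : Spec (.of k)),
    (((isRingActionBT_pDivisibleGroupMap act hpr.out.ne_zero hg).homOfCompatibleFamily a
      (sub_mem_span_pow hx hcop ha1 ha2)).fixLayer n).hom.finrank s = p ^ (n * (2 * e * f)))
  -- SOCKET (S-T): the Lie signature of `e_w` on `A` is `1` (GEN: Kottwitz at the point), in ★ DEAL 6 currency
  (hsig : ∀ n, 0 < n → haveI := act.isMonHom_i (a n);
    Module.finrank k (LinearMap.range (cotangentMap A.toAffine.toAbelianVariety
      (InducedCategory.homMk (Grp.ofHom (A := A.X) (B := A.X) (act.i (a n)))))) = 1)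

set_option synthInstance.maxHeartbeats 200000 in
include hw0 hpw hf he hrank hsig in
/-- **HEAD `blockDocking_of_line` (ED. 7) — the Defs v0.5b field block `G₀ grp₀ comm₀ aff₀ fin₀ β₀ hβ₀ ι₀G hι₀G hkerG₀ hβ₀G U₀ grpU₀ affU₀ jU₀ hU₀ NU₀ θU₀ hFFU₀ hrkG₀ hrkF₀ hpts₀ hsimple₀` for `A`,
from the sockets (S-H) `hrank` and (S-T) `hsig`.**  SORRY-FREE composition of ★ (O-CRT) §4, ★ (O-DOCK) `exists_blockDocking`,
★ DEAL 6 `htan_hdim_block_of_lieSignature`, ★ `exists_unitComponent` and the ★-boxed P6b kit `blockNumerics_of_line` (instantiated at `𝒪 := Localization.AtPrime w`, `H := 2ef`,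
`σO := O`, `ρ := algebraMap`).  [cite: Tate1967, §2 (2.1)–(2.4)] [cite: HarrisTaylorAMS2001, §II.1–II.2] [cite: RapoportSmithlingZhang2020Diagonal, §4.1 (p. 17)]
[cite: Liu2021, p. 136] -/
theorem blockDocking_of_line :
    ∃ (G : SchemeOver k) (_ : GrpObj G) (_ : IsCommMonObj G) (_ : IsAffine G.left) (_ : IsFinite G.hom) (ιA : G ⟶ A.X) (βG : O → (G ⟶ G))
      (U : SchemeOver k) (_ : GrpObj U) (_ : IsAffine U.left) (jU : U ⟶ G)
      (NU : ℕ) (_θU : (k[X] ⧸ Ideal.span {(X : k[X]) ^ (p ^ NU)}) ≃ₐ[k] Alg U),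
      (IsMonHom ιA ∧ IsClosedImmersion ιA.left) ∧
      (∀ ⦃T : SchemeOver k⦄ (t : T ⟶ A.X), (∀ r ∈ w, t ≫ act.i r = 1) ↔ ∃ s : T ⟶ G, s ≫ ιA = t) ∧
      (∀ c, βG c ≫ ιA = ιA ≫ act.i c) ∧ (∀ c, IsMonHom (βG c)) ∧
      (IsMonHom jU ∧ IsOpenImmersion jU.left ∧ IsClosedImmersion jU.left ∧ ConnectedSpace ↥U.left) ∧
      (NU = f ∨ NU = f + f) ∧
      jU ≫ relFrobeniusOver p f G ≫ relFrobeniusOver p f (frobeniusTwistOver p f G) = 1 ∧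
      Module.finrank k (Alg G) = p ^ f * p ^ f ∧
      Module.finrank k (Alg G ⧸ (RingHom.ker (kerι (relFrobeniusOver p f G)).left.appTop.hom : Ideal (Alg G))) = p ^ f ∧
      (Nat.card (𝟙_ (SchemeOver k) ⟶ G) = 1 ∨ Nat.card (𝟙_ (SchemeOver k) ⟶ G) = p ^ f) ∧
      ∀ Λ : Subgroup (𝟙_ (SchemeOver k) ⟶ G), (∀ c, ∀ x ∈ Λ, x ≫ βG c ∈ Λ) → Λ = ⊥ ∨ Λ = ⊤ := by
  have hp : p.Prime := hpr.out
  -- 𝒪-numerics of `𝒪 := O_w` (★ (O-CRT) §4 + Mathlib)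
  haveI : IsDiscreteValuationRing (Localization.AtPrime w) :=
    IsLocalization.AtPrime.isDiscreteValuationRing_of_dedekind_domain O hw0 _
  haveI : Finite (O ⧸ w) := Nat.finite_of_card_ne_zero (by rw [hf]; exact pow_ne_zero _ hp.ne_zero)
  haveI : Finite (IsLocalRing.ResidueField (Localization.AtPrime w)) := finite_residueField_localizationAtPrime w
  have hq : Nat.card (IsLocalRing.ResidueField (Localization.AtPrime w)) = p ^ f :=
    natCard_residueField_localizationAtPrime_eq_pow w hf
  obtain ⟨ϖ, hϖ, hpe⟩ := associated_pow_natCast w hw0 p hx hcop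
  have hϖmax : IsLocalRing.maximalIdeal (Localization.AtPrime w) = Ideal.span {ϖ} := hϖ.maximalIdeal_eq
  have hρ := residue_algebraMap_localizationAtPrime_surjective (R := O) w
  -- ★ (O-DOCK): the block `Bw`, its `O_w`-action, `G := Ker (βw ϖ)₁` and the `A`-side
  obtain ⟨βw, hβw, hβwR, hkill, ⟨hGc, hGaff, hGfin⟩, hker, βG, hβG, hβGmon, hιAmon, hιAci, hkerA, hβGA⟩ :=
    exists_blockDocking hp.ne_zero hg act w hx hcop a ha1 ha2 (2 * e * f) hrank he hpw ϖ hϖmax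
  letI := ((((isRingActionBT_pDivisibleGroupMap act hp.ne_zero hg).homOfCompatibleFamily a
      (sub_mem_span_pow hx hcop ha1 ha2)).fixBTGroup ((isRingActionBT_pDivisibleGroupMap act hp.ne_zero hg).homOfCompatibleFamily_idem a
      (sub_mem_span_pow hx hcop ha1 ha2) (mul_self_sub_mem_span_pow hx hcop ha1 ha2)) (2 * e * f) hrank).grpObj 1)
  haveI := (βw ϖ).isMonHom_app 1
  -- ED. 7: `G := Ker (βw ϖ)₁` is commutative (P6a v0.5b field `comm₀`): ★ `BTGroup.comm` + ★ `isCommMonObj_ker`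
  haveI : IsCommMonObj (ker ((βw ϖ).app 1)) :=
    haveI := ((((isRingActionBT_pDivisibleGroupMap act hp.ne_zero hg).homOfCompatibleFamily a
      (sub_mem_span_pow hx hcop ha1 ha2)).fixBTGroup ((isRingActionBT_pDivisibleGroupMap act hp.ne_zero hg).homOfCompatibleFamily_idem a
      (sub_mem_span_pow hx hcop ha1 ha2) (mul_self_sub_mem_span_pow hx hcop ha1 ha2)) (2 * e * f) hrank).comm 1)
    GroupSchemeKernel.isCommMonObj_ker ((βw ϖ).app 1)
  haveI := hGaff
  haveI := hGfin
  -- ★ (b1a): a unit component of `G`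
  obtain ⟨U, instU, jU, hU⟩ := exists_unitComponent k (ker ((βw ϖ).app 1))
  haveI : IsAffineHom U.hom := by rw [← Over.w jU]; haveI := hU.2.2.1; infer_instance
  haveI : IsAffine U.left := AffineGroupScheme.isAffine_left_of_isAffineHom U
  -- ★ DEAL 6: the kit՚s tangent tokens from the Lie signature
  obtain ⟨htan, hdim⟩ := htan_hdim_block_of_lieSignature (hp := hp.ne_zero) (hg := hg) (act := act) (w := w) (hx := hx)
    (hcop := hcop) (a := a) (ha1 := ha1) (ha2 := ha2) (h₁ := 2 * e * f) (hrank := hrank) hsig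
  -- the ★-boxed kit
  obtain ⟨NU, θU, hNU, hFF, hrkG, hrkF, hpts, hsimple⟩ :=
    blockNumerics_of_line p f (Localization.AtPrime w) hq ϖ hϖ e he hpe (H := 2 * e * f) rfl _ βw hβw htan hdim
      (ker ((βw ϖ).app 1)) (kerι ((βw ϖ).app 1)) ⟨inferInstance, hGc⟩ hker
      (algebraMap O (Localization.AtPrime w)) hρ βG hβG U jU hU
  exact ⟨ker ((βw ϖ).app 1), inferInstance, inferInstance, hGaff, hGfin, _, βG, U, instU, inferInstance, jU, NU, θU, ⟨hιAmon, hιAci⟩, hkerA, hβGA,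
    hβGmon, hU, hNU, hFF, hrkG, hrkF, hpts, hsimple⟩

end Head

end Literature.AlgebraicGeometry.AbelianSchemes.PDivisibleGroupBlockDockingOfLine

end
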